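import Summits.HodgeConjecture.HodgeConjecture.Theorems.TropicalKugaSatakeCayleyEffectiveCayleyNonRealizabilityCycleClassHodge
import HarnessLib

/-!
# The eigenwave in position-free coordinates: reduction of `eigenwave (compound 2 B · M) = 0` to a
# three-term slice system — crux `EffectiveCayleyNonRealizability` (stmt-HodgeConjecture-18569),
# rung `stub_rung_sixthDirection` of line `formal_rational`

Route `TropicalKugaSatakeCayley` of `HodgeConjecture`, chain encoding
`Literature.AlgebraicGeometry.Tropical.TropicalTorus` (any `g`, `p = 2`, any commutative ring).
The eigenwave condition `eigenwave (compound 2 B · M) = 0` on a class `M ∈ ⋀² ⊗ ⋀²` in period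
coordinates looks QUADRATIC in the period matrix `B`, but it factors (`eigenwave_compound_two_mul_apply`):
the `({a}, {j₀ < j₁ < j₂})` entry of `eigenwave (compound 2 B · M)` is
`-Σ_x B_{a x} · (Σ_{x'} B_{j₀ x'} N(x, x'; j₁, j₂) + Σ_{x'} B_{j₁ x'} N(x, x'; j₂, j₀) + Σ_{x'} B_{j₂ x'} N(x, x'; j₀, j₁))`,
where `N(x, x'; j, j') = ± M_{{x,x'},{j,j'}}` is the antisymmetric (ordered-pair) reading of `M`.
This is the prior programme's observation that the eigenwave transported to position-free
coordinates, `Ψ_B(l₁ ∧ l₂ ⊗ ν) = l₂ ⊗ (B l₁ ∧ ν) - l₁ ⊗ (B l₂ ∧ ν)`, is LINEAR in `B`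
(paper-v2, §1.2, eq. (psi)); the extra factor `B` in front is harmless when `B` is invertible.
Consequently (`sliceSystem_of_eigenwave_eq_zero`), for `B` with a left inverse, the eigenwave
condition is equivalent to the family of three-term equations
`Σ_{x'} B_{k₁x'} N(x,x';k₂,k₃) + Σ_{x'} B_{k₂x'} N(x,x';k₃,k₁) + Σ_{x'} B_{k₃x'} N(x,x';k₁,k₂) = 0`
for every slice `x` and ALL `k₁, k₂, k₃` (the degenerate and permuted cases follow from
antisymmetry). This is the input format of the kernel certificate
(`…SixthDirectionKernelBlock`, `…SixthDirectionKernelCore`).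

No definition, no named fact, no sorry.
References: [MikhalkinZharkov2014Eigenwave] G. Mikhalkin, I. Zharkov, Tropical eigenwave and
intermediate Jacobians, LN UMI 15 (2014), §5.1–5.2, Thm. 5.4; [Zharkov2020TropicalWeil]
I. Zharkov, arXiv:2002.02347, p. 2; prior programme archive `hodge-neg/tropical-kuga-satake`,
paper-v2 §1.2 (position-free coordinates).
-/

noncomputable section

-- `Summit.HodgeConjecture.HodgeConjecture.…` is the mandated namespace (single-conjunct summit).
set_option linter.dupNamespace false

open scoped BigOperators Matrix

namespace Summit.HodgeConjecture.HodgeConjecture.Theorems.EffectiveCayleyNonRealizability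

open Literature.AlgebraicGeometry.Tropical
open Literature.AlgebraicGeometry.Tropical.TropicalTorus
open Summit.HodgeConjecture.HodgeConjecture.Theorems.FormalCycleCriterion

section Slice

variable {S : Type*} [CommRing S] {g : ℕ}

/-- A `2 × 2` minor of `B` is the Plücker coordinate of the corresponding two-column frame of `B`.
[folklore] -/
theorem minor_eq_pluecker_cols (B : Matrix (Fin g) (Fin g) S) (K I : Sub g 2) :
    minor B K I = pluecker (Matrix.of fun x t => B x (I.1.orderEmbOfFin I.2 t)) K := by
  rw [minor_two, pluecker_two]
  simp only [Matrix.of_apply]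

/-- **The antisymmetric double sum vanishes**: `Σ_x Σ_{x'} B_{a x} B_{a x'} N(x, x') = 0` when
`N(x', x) = -N(x, x')` and `N(x, x) = 0` (valid in any commutative ring: pair the terms).
[folklore] -/
theorem sum_sum_row_mul_row_mul_antisymm_eq_zero (B : Matrix (Fin g) (Fin g) S) (a : Fin g)
    (F : Fin g → Fin g → S) (ha : ∀ x x', F x' x = -F x x') (hd : ∀ x, F x x = 0) :
    ∑ x, B a x * ∑ x', B a x' * F x x' = 0 := by
  have h := sum_sum_eq_sum_lt_add (fun x x' => B a x * (B a x' * F x x'))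
    (fun x => by simp only [hd, mul_zero])
  simp only [Finset.mul_sum]
  rw [h]
  refine Finset.sum_eq_zero fun ab _ => ?_
  rw [ha ab.1 ab.2]
  ring

/-- **The signed pair sum.** For `a ≠ k` and a `2`-subset `E = {p < q}`:
`(-1)^{#{a' ∈ {a} : a' < k}} · Σ_I minor(B; insert k {a}; I) · M_{I E} = -Σ_x B_{a x} Σ_{x'} B_{k x'} N(x, x'; p, q)`,
where `N` is the antisymmetric reading of `M` in the first index pair (Cauchy–Binet for the row
pair `(a, k)` plus the sign of `sign_mul_pluecker_insert`). [folklore] -/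
theorem sign_mul_sum_minor_insert_mul (B : Matrix (Fin g) (Fin g) S)
    (M : Matrix (Sub g 2) (Sub g 2) S) (N : Fin g → Fin g → Fin g → Fin g → S)
    (hN : ∀ (x x' j j' : Fin g) (hx : x < x') (hj : j < j'),
      N x x' j j' = M ⟨{x, x'}, Finset.card_pair hx.ne⟩ ⟨{j, j'}, Finset.card_pair hj.ne⟩)
    (ha₁ : ∀ x x' j j', N x' x j j' = -N x x' j j') (hd₁ : ∀ x j j', N x x j j' = 0)
    {a k : Fin g} (hak : a ≠ k) (h : (insert k ({a} : Finset (Fin g))).card = 2)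
    {p q : Fin g} (hpq : p < q) (E : Sub g 2) (hE : E.1 = {p, q}) :
    (-1 : S) ^ (({a} : Finset (Fin g)).filter (· < k)).card *
        ∑ I : Sub g 2, minor B ⟨insert k {a}, h⟩ I * M I E =
      -∑ x, B a x * ∑ x', B k x' * N x x' p q := by
  -- `M I E = N i₀ i₁ p q`
  have hME : ∀ I : Sub g 2,
      M I E = N (I.1.orderEmbOfFin I.2 0) (I.1.orderEmbOfFin I.2 1) p q := by
    intro I
    have hi : I.1.orderEmbOfFin I.2 0 < I.1.orderEmbOfFin I.2 1 :=
      (I.1.orderEmbOfFin I.2).strictMono (by decide)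
    rw [hN _ _ _ _ hi hpq]
    congr 1
    · exact Subtype.ext (pair_orderEmbOfFin_eq I).symm
    · exact Subtype.ext hE
  -- signed minors, summand by summand
  have hsum : (-1 : S) ^ (({a} : Finset (Fin g)).filter (· < k)).card *
      ∑ I : Sub g 2, minor B ⟨insert k {a}, h⟩ I * M I E =
      ∑ I : Sub g 2, -((B a (I.1.orderEmbOfFin I.2 0) * B k (I.1.orderEmbOfFin I.2 1) -
        B a (I.1.orderEmbOfFin I.2 1) * B k (I.1.orderEmbOfFin I.2 0)) *
        N (I.1.orderEmbOfFin I.2 0) (I.1.orderEmbOfFin I.2 1) p q) := by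
    rw [Finset.mul_sum]
    refine Finset.sum_congr rfl fun I _ => ?_
    rw [← mul_assoc, minor_eq_pluecker_cols,
      sign_mul_pluecker_insert (Matrix.of fun x t => B x (I.1.orderEmbOfFin I.2 t)) hak h, hME I]
    simp only [Matrix.of_apply, neg_mul]
  rw [hsum]
  -- the sum over `2`-subsets as a sum over ordered pairs, then as a double sum
  have hlt := sum_sub_two_eq_sum_lt
    (fun x x' => -((B a x * B k x' - B a x' * B k x) * N x x' p q))
  rw [hlt]
  have hdbl := sum_sum_eq_sum_lt_add (fun x x' => B a x * (B k x' * N x x' p q))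
    (fun x => by simp only [hd₁, mul_zero])
  simp only [Finset.mul_sum]
  rw [hdbl, ← Finset.sum_neg_distrib]
  refine Finset.sum_congr rfl fun ab _ => ?_
  rw [ha₁ ab.1 ab.2]
  ring

/-- **The eigenwave in position-free coordinates** (entry formula). For every `B`, every class
`M ∈ ⋀² ⊗ ⋀²` and its antisymmetric reading `N(x, x'; j, j') = ± M_{{x,x'},{j,j'}}`:
the `({a}, {j₀ < j₁ < j₂})` entry of `eigenwave (compound 2 B · M)` equals
`-Σ_x B_{a x} (Σ_{x'} B_{j₀x'} N(x,x';j₁,j₂) + Σ_{x'} B_{j₁x'} N(x,x';j₂,j₀) + Σ_{x'} B_{j₂x'} N(x,x';j₀,j₁))`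
— `B` applied to an expression LINEAR in `B` (the prior programme's `Ψ_B`, position-free
coordinates). [cite: MikhalkinZharkov2014Eigenwave, §5.1–5.2] [cite: Zharkov2020TropicalWeil, p. 2] -/
theorem eigenwave_compound_two_mul_apply (B : Matrix (Fin g) (Fin g) S)
    (M : Matrix (Sub g 2) (Sub g 2) S) (N : Fin g → Fin g → Fin g → Fin g → S)
    (hN : ∀ (x x' j j' : Fin g) (hx : x < x') (hj : j < j'),
      N x x' j j' = M ⟨{x, x'}, Finset.card_pair hx.ne⟩ ⟨{j, j'}, Finset.card_pair hj.ne⟩)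
    (ha₁ : ∀ x x' j j', N x' x j j' = -N x x' j j') (hd₁ : ∀ x j j', N x x j j' = 0)
    (ha₂ : ∀ x x' j j', N x x' j' j = -N x x' j j')
    (a : Fin g) (ha : ({a} : Finset (Fin g)).card = 1) (J : Sub g 3) :
    eigenwave (q := 1) (compound 2 B * M) ⟨{a}, ha⟩ J =
      -∑ x, B a x *
        (∑ x', B (J.1.orderEmbOfFin J.2 0) x' *
            N x x' (J.1.orderEmbOfFin J.2 1) (J.1.orderEmbOfFin J.2 2) +
          ∑ x', B (J.1.orderEmbOfFin J.2 1) x' *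
            N x x' (J.1.orderEmbOfFin J.2 2) (J.1.orderEmbOfFin J.2 0) +
          ∑ x', B (J.1.orderEmbOfFin J.2 2) x' *
            N x x' (J.1.orderEmbOfFin J.2 0) (J.1.orderEmbOfFin J.2 1)) := by
  simp only [eigenwave, Matrix.of_apply]
  set j : Fin 3 ↪o Fin g := J.1.orderEmbOfFin J.2 with hj
  have hJ : ({j 0, j 1, j 2} : Finset (Fin g)) = J.1 := triple_orderEmbOfFin_eq J
  have h01 : j 0 < j 1 := j.strictMono (by decide)
  have h12 : j 1 < j 2 := j.strictMono (by decide)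
  have h02 : j 0 < j 2 := h01.trans h12
  -- erased pairs
  have he0 : J.1.erase (j 0) = {j 1, j 2} := by
    rw [← hJ, Finset.erase_insert]
    simp only [Finset.mem_insert, Finset.mem_singleton, not_or]
    exact ⟨h01.ne, h02.ne⟩
  have he1 : J.1.erase (j 1) = {j 0, j 2} := by
    rw [← hJ, Finset.erase_insert_of_ne h01.ne, Finset.erase_insert]
    simp only [Finset.mem_singleton]; exact h12.ne
  have he2 : J.1.erase (j 2) = {j 0, j 1} := by
    rw [← hJ, Finset.erase_insert_of_ne h02.ne, Finset.erase_insert_of_ne h12.ne,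
      Finset.erase_singleton]
    rfl
  -- positions inside `J`
  have hpos : ∀ m : Fin 3, (J.1.filter (· < j m)).card = (m : ℕ) := by
    intro m
    rw [← hJ]
    fin_cases m
    · have : ({j 0, j 1, j 2} : Finset (Fin g)).filter (· < j 0) = ∅ := by
        ext x
        simp only [Finset.mem_filter, Finset.mem_insert, Finset.mem_singleton,
          Finset.notMem_empty, iff_false, not_and]
        rintro (rfl | rfl | rfl)
        · exact lt_irrefl _
        · exact not_lt.2 h01.le
        · exact not_lt.2 h02.le
      simp [this]
    · have : ({j 0, j 1, j 2} : Finset (Fin g)).filter (· < j 1) = {j 0} := by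
        ext x
        simp only [Finset.mem_filter, Finset.mem_insert, Finset.mem_singleton]
        constructor
        · rintro ⟨rfl | rfl | rfl, hx⟩
          · rfl
          · exact absurd hx (lt_irrefl _)
          · exact absurd hx (not_lt.2 h12.le)
        · rintro rfl; exact ⟨Or.inl rfl, h01⟩
      simp [this]
    · have : ({j 0, j 1, j 2} : Finset (Fin g)).filter (· < j 2) = {j 0, j 1} := by
        ext x
        simp only [Finset.mem_filter, Finset.mem_insert, Finset.mem_singleton]
        constructor
        · rintro ⟨rfl | rfl | rfl, hx⟩
          · exact Or.inl rfl
          · exact Or.inr rfl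
          · exact absurd hx (lt_irrefl _)
        · rintro (rfl | rfl)
          · exact ⟨Or.inl rfl, h02⟩
          · exact ⟨Or.inr (Or.inl rfl), h12⟩
      simp [this, Finset.card_pair h01.ne]
  -- the pair sums `W m p q := Σ_x B_{a x} Σ_{x'} B_{j_m x'} N(x, x'; p, q)`
  -- each summand at `k = j m`, uniformly (for `a = j m` there is no summand and `W` vanishes)
  have hterm : ∀ (m : Fin 3) (p q : Fin g), p < q → J.1.erase (j m) = {p, q} →
      (if h : j m ∉ ({a} : Finset (Fin g)) ∧ j m ∈ J.1 then
          (-1 : S) ^ ((({a} : Finset (Fin g)).filter (· < j m)).card +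
              (J.1.filter (· < j m)).card) *
            (compound 2 B * M) ⟨insert (j m) {a}, by
                rw [Finset.card_insert_of_notMem h.1, ha]⟩
              ⟨J.1.erase (j m), by rw [Finset.card_erase_of_mem h.2, J.2]⟩
        else 0) =
        (-1 : S) ^ ((m : ℕ) + 1) * ∑ x, B a x * ∑ x', B (j m) x' * N x x' p q := by
    intro m p q hpq he
    have hmem : j m ∈ J.1 := Finset.orderEmbOfFin_mem _ _ _
    by_cases ham : a = j m
    · have hnot : ¬(j m ∉ ({a} : Finset (Fin g)) ∧ j m ∈ J.1) := fun h => h.1 (by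
        rw [← ham]; exact Finset.mem_singleton_self a)
      rw [dif_neg hnot, ← ham,
        sum_sum_row_mul_row_mul_antisymm_eq_zero B a (fun x x' => N x x' p q)
          (fun x x' => ha₁ x x' p q) (fun x => hd₁ x p q), mul_zero]
    · have hcond : j m ∉ ({a} : Finset (Fin g)) ∧ j m ∈ J.1 :=
        ⟨by simpa using Ne.symm ham, hmem⟩
      rw [dif_pos hcond, pow_add, hpos m, Matrix.mul_apply]
      have hcard : (insert (j m) ({a} : Finset (Fin g))).card = 2 := by
        rw [Finset.card_insert_of_notMem (by simpa using Ne.symm ham), Finset.card_singleton]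
      have hE : (⟨J.1.erase (j m), by rw [Finset.card_erase_of_mem hcond.2, J.2]⟩ : Sub g 2).1 =
          {p, q} := he
      have key := sign_mul_sum_minor_insert_mul B M N hN ha₁ hd₁ ham hcard hpq _ hE
      simp only [compound, Matrix.of_apply] at key ⊢
      calc (-1 : S) ^ (({a} : Finset (Fin g)).filter (· < j m)).card * (-1 : S) ^ (m : ℕ) *
            ∑ I : Sub g 2, minor B ⟨insert (j m) {a}, _⟩ I * M I ⟨J.1.erase (j m), _⟩
          = (-1 : S) ^ (m : ℕ) * ((-1 : S) ^ (({a} : Finset (Fin g)).filter (· < j m)).card *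
              ∑ I : Sub g 2, minor B ⟨insert (j m) {a}, hcard⟩ I * M I ⟨J.1.erase (j m), _⟩) := by
            ring
        _ = (-1 : S) ^ ((m : ℕ) + 1) * ∑ x, B a x * ∑ x', B (j m) x' * N x x' p q := by
            rw [key]; ring
  -- restrict the sum to `J = {j 0, j 1, j 2}` and expand
  rw [← Finset.sum_subset (Finset.subset_univ J.1)
    (fun k _ hk => by rw [dif_neg (fun h => hk h.2)])]
  rw [← Finset.sum_congr hJ (fun _ _ => rfl)]
  have hn0 : j 0 ∉ ({j 1, j 2} : Finset (Fin g)) := by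
    simp only [Finset.mem_insert, Finset.mem_singleton, not_or]; exact ⟨h01.ne, h02.ne⟩
  have hn1 : j 1 ∉ ({j 2} : Finset (Fin g)) := by
    simp only [Finset.mem_singleton]; exact h12.ne
  rw [Finset.sum_insert hn0, Finset.sum_insert hn1, Finset.sum_singleton,
    hterm 0 (j 1) (j 2) h12 he0, hterm 1 (j 0) (j 2) h02 he1, hterm 2 (j 0) (j 1) h01 he2]
  -- reorient the middle pair `(j 0, j 2) ↦ (j 2, j 0)`
  have hmid : ∑ x, B a x * ∑ x', B (j 1) x' * N x x' (j 0) (j 2) =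
      -∑ x, B a x * ∑ x', B (j 1) x' * N x x' (j 2) (j 0) := by
    rw [← Finset.sum_neg_distrib]
    refine Finset.sum_congr rfl fun x _ => ?_
    rw [← mul_neg, ← Finset.sum_neg_distrib]
    congr 1
    refine Finset.sum_congr rfl fun x' _ => ?_
    rw [ha₂ x x' (j 2) (j 0)]; ring
  rw [hmid]
  simp only [Fin.val_zero, Fin.val_one, Fin.val_two, mul_add, Finset.sum_add_distrib]
  ring

/-- **The slice system from the eigenwave condition** (increasing triples). If `B' · B = 1` and
`eigenwave (compound 2 B · M) = 0`, then for every slice `x` and all `j₀ < j₁ < j₂`: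
`Σ_{x'} B_{j₀x'} N(x,x';j₁,j₂) + Σ_{x'} B_{j₁x'} N(x,x';j₂,j₀) + Σ_{x'} B_{j₂x'} N(x,x';j₀,j₁) = 0`.
[cite: MikhalkinZharkov2014Eigenwave, Thm. 5.4] -/
theorem sliceSystem_of_eigenwave_eq_zero_lt (B B' : Matrix (Fin g) (Fin g) S) (hB : B' * B = 1)
    (M : Matrix (Sub g 2) (Sub g 2) S) (N : Fin g → Fin g → Fin g → Fin g → S)
    (hN : ∀ (x x' j j' : Fin g) (hx : x < x') (hj : j < j'),
      N x x' j j' = M ⟨{x, x'}, Finset.card_pair hx.ne⟩ ⟨{j, j'}, Finset.card_pair hj.ne⟩)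
    (ha₁ : ∀ x x' j j', N x' x j j' = -N x x' j j') (hd₁ : ∀ x j j', N x x j j' = 0)
    (ha₂ : ∀ x x' j j', N x x' j' j = -N x x' j j')
    (h : eigenwave (q := 1) (compound 2 B * M) = 0)
    (x j₀ j₁ j₂ : Fin g) (h01 : j₀ < j₁) (h12 : j₁ < j₂) :
    ∑ x', B j₀ x' * N x x' j₁ j₂ + ∑ x', B j₁ x' * N x x' j₂ j₀ +
      ∑ x', B j₂ x' * N x x' j₀ j₁ = 0 := by
  classical
  -- the `3`-subset `{j₀, j₁, j₂}` and its enumeration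
  have h02 : j₀ < j₂ := h01.trans h12
  have hcard : ({j₀, j₁, j₂} : Finset (Fin g)).card = 3 := by
    rw [Finset.card_insert_of_notMem, Finset.card_pair h12.ne]
    simp only [Finset.mem_insert, Finset.mem_singleton, not_or]
    exact ⟨h01.ne, h02.ne⟩
  set J : Sub g 3 := ⟨{j₀, j₁, j₂}, hcard⟩ with hJdef
  -- its increasing enumeration is `j₀, j₁, j₂`
  have henum : ∀ m : Fin 3, J.1.orderEmbOfFin J.2 m = ![j₀, j₁, j₂] m := by
    have hmono : StrictMono (![j₀, j₁, j₂] : Fin 3 → Fin g) := by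
      refine Fin.strictMono_iff_lt_succ.2 fun i => ?_
      fin_cases i
      · exact h01
      · exact h12
    have himg : ∀ m, (![j₀, j₁, j₂] : Fin 3 → Fin g) m ∈ J.1 := by
      intro m; fin_cases m <;> simp [hJdef]
    intro m
    have := Finset.orderEmbOfFin_unique J.2 himg hmono
    exact (congr_fun this m).symm
  -- the vector `v(x) = Σ_cyc …` is killed by `B`, hence by `B' B = 1`
  set v : Fin g → S := fun x =>
    ∑ x', B j₀ x' * N x x' j₁ j₂ + ∑ x', B j₁ x' * N x x' j₂ j₀ +
      ∑ x', B j₂ x' * N x x' j₀ j₁ with hv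
  have hBv : B.mulVec v = 0 := by
    ext a
    have e := eigenwave_compound_two_mul_apply B M N hN ha₁ hd₁ ha₂ a (Finset.card_singleton a) J
    rw [h, Matrix.zero_apply, henum 0, henum 1, henum 2] at e
    simp only [Matrix.cons_val_zero, Matrix.cons_val_one, Matrix.head_cons,
      Matrix.cons_val_two, Matrix.tail_cons] at e
    rw [Matrix.mulVec, Pi.zero_apply]
    simp only [dotProduct, hv]
    rw [eq_comm, neg_eq_zero] at e
    exact e
  have hv0 : v = 0 := by
    have := congr_arg B'.mulVec hBv
    rwa [Matrix.mulVec_mulVec, hB, Matrix.one_mulVec, Matrix.mulVec_zero] at this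
  have := congr_fun hv0 x
  simpa only [hv, Pi.zero_apply] using this

/-- **The slice system from the eigenwave condition** (all triples). If `B' · B = 1` and
`eigenwave (compound 2 B · M) = 0`, then for every slice `x` and ALL `k₁, k₂, k₃`:
`Σ_{x'} B_{k₁x'} N(x,x';k₂,k₃) + Σ_{x'} B_{k₂x'} N(x,x';k₃,k₁) + Σ_{x'} B_{k₃x'} N(x,x';k₁,k₂) = 0`
(cyclic symmetry is built in; transpositions change the sign and coincidences give `0`, by the
antisymmetry of `N` in its last two arguments). [cite: MikhalkinZharkov2014Eigenwave, Thm. 5.4] -/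
theorem sliceSystem_of_eigenwave_eq_zero (B B' : Matrix (Fin g) (Fin g) S) (hB : B' * B = 1)
    (M : Matrix (Sub g 2) (Sub g 2) S) (N : Fin g → Fin g → Fin g → Fin g → S)
    (hN : ∀ (x x' j j' : Fin g) (hx : x < x') (hj : j < j'),
      N x x' j j' = M ⟨{x, x'}, Finset.card_pair hx.ne⟩ ⟨{j, j'}, Finset.card_pair hj.ne⟩)
    (ha₁ : ∀ x x' j j', N x' x j j' = -N x x' j j') (hd₁ : ∀ x j j', N x x j j' = 0)
    (ha₂ : ∀ x x' j j', N x x' j' j = -N x x' j j') (hd₂ : ∀ x x' j, N x x' j j = 0)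
    (h : eigenwave (q := 1) (compound 2 B * M) = 0) (x k₁ k₂ k₃ : Fin g) :
    ∑ x', B k₁ x' * N x x' k₂ k₃ + ∑ x', B k₂ x' * N x x' k₃ k₁ +
      ∑ x', B k₃ x' * N x x' k₁ k₂ = 0 := by
  -- the cyclic expression `E k₁ k₂ k₃`, its symmetries
  have hswap : ∀ k₁ k₂ k₃ : Fin g,
      ∑ x', B k₂ x' * N x x' k₁ k₃ + ∑ x', B k₁ x' * N x x' k₃ k₂ +
        ∑ x', B k₃ x' * N x x' k₂ k₁ =
      -(∑ x', B k₁ x' * N x x' k₂ k₃ + ∑ x', B k₂ x' * N x x' k₃ k₁ +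
        ∑ x', B k₃ x' * N x x' k₁ k₂) := by
    intro k₁ k₂ k₃
    have e : ∀ (k p q : Fin g), ∑ x', B k x' * N x x' q p = -∑ x', B k x' * N x x' p q := by
      intro k p q
      rw [← Finset.sum_neg_distrib]
      exact Finset.sum_congr rfl fun x' _ => by rw [ha₂ x x' p q]; ring
    rw [e k₂ k₃ k₁, e k₁ k₂ k₃, e k₃ k₁ k₂]
    ring
  have hdeg : ∀ k k₃ : Fin g,
      ∑ x', B k x' * N x x' k k₃ + ∑ x', B k x' * N x x' k₃ k +
        ∑ x', B k₃ x' * N x x' k k = 0 := by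
    intro k k₃
    have e3 : ∑ x', B k₃ x' * N x x' k k = 0 :=
      Finset.sum_eq_zero fun x' _ => by rw [hd₂ x x' k, mul_zero]
    rw [e3, add_zero, ← Finset.sum_add_distrib]
    exact Finset.sum_eq_zero fun x' _ => by rw [ha₂ x x' k k₃]; ring
  have hlt := sliceSystem_of_eigenwave_eq_zero_lt B B' hB M N hN ha₁ hd₁ ha₂ h x
  -- case analysis on the order type of `(k₁, k₂, k₃)`
  rcases lt_trichotomy k₁ k₂ with h12 | rfl | h21
  · rcases lt_trichotomy k₂ k₃ with h23 | rfl | h32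
    · exact hlt k₁ k₂ k₃ h12 h23
    · -- `k₂ = k₃`: a cyclic rotation of the degenerate identity
      have := hdeg k₂ k₁
      linear_combination this
    · rcases lt_trichotomy k₁ k₃ with h13 | rfl | h31
      · -- `k₁ < k₃ < k₂`
        have e := hlt k₁ k₃ k₂ h13 h32
        have s := hswap k₁ k₃ k₂
        linear_combination s - e
      · have := hdeg k₁ k₂
        linear_combination this
      · -- `k₃ < k₁ < k₂`: cyclic rotation of the increasing triple `(k₃, k₁, k₂)`
        have e := hlt k₃ k₁ k₂ h31 h12
        linear_combination e
  · have := hdeg k₁ k₃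
    linear_combination this
  · rcases lt_trichotomy k₁ k₃ with h13 | rfl | h31
    · -- `k₂ < k₁ < k₃`
      have e := hlt k₂ k₁ k₃ h21 h13
      have s := hswap k₂ k₁ k₃
      linear_combination s - e
    · have := hdeg k₁ k₂
      linear_combination this
    · rcases lt_trichotomy k₂ k₃ with h23 | rfl | h32
      · -- `k₂ < k₃ < k₁`: cyclic rotation of `(k₂, k₃, k₁)`
        have e := hlt k₂ k₃ k₁ h23 h31
        linear_combination e
      · have := hdeg k₂ k₁
        linear_combination this
      · -- `k₃ < k₂ < k₁`: transposition of `(k₃, k₂, k₁)`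
        have e := hlt k₃ k₂ k₁ h32 h21
        have s := hswap k₃ k₂ k₁
        linear_combination s - e

end Slice

end Summit.HodgeConjecture.HodgeConjecture.Theorems.EffectiveCayleyNonRealizability

end
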